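import Summits.BirchSwinnertonDyer.BirchSwinnertonDyer.Theorems.GoldfeldAllTwistsTwoConverseTwinQuarterTraceChiZCore
import Summits.BirchSwinnertonDyer.BirchSwinnertonDyer.Theorems.GoldfeldAllTwistsTwoConverseTwinQuarterTraceChiZPrep
import Summits.BirchSwinnertonDyer.BirchSwinnertonDyer.Theorems.GoldfeldAllTwistsTwoConverseTwinQuarterTraceSignaturesEAlphaPlusModFourAlpha
import Summits.BirchSwinnertonDyer.BirchSwinnertonDyer.Theorems.GoldfeldAllTwistsTwoConverseTwinQuarterTraceSignaturesPAlphaPlusModFourAlpha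
import Summits.BirchSwinnertonDyer.BirchSwinnertonDyer.Theorems.GoldfeldAllTwistsTwoConverseTwinQuarterTraceSignaturesQPModFourAlpha
import Summits.BirchSwinnertonDyer.BirchSwinnertonDyer.Theorems.GoldfeldAllTwistsTwoConverseTwinQuarterTraceChiZNonTorsion
import Summits.BirchSwinnertonDyer.BirchSwinnertonDyer.Theorems.GoldfeldAllTwistsTwoConverseTwinQuarterTraceChiZAlpha
import Summits.BirchSwinnertonDyer.BirchSwinnertonDyer.Theorems.GoldfeldAllTwistsTwoConverseTwinQuarterTracePartnerPHeightModFour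
import HarnessLib

set_option linter.dupNamespace false -- namespace `…BirchSwinnertonDyer.BirchSwinnertonDyer…` is the cell's (D-0017 nested layout)
set_option autoImplicit false

/-!
# ORDER (ccclxxxii) tranche T3 = Z⁺-1: `…QuarterTraceChiZAlphaPlusModFourAlpha` — the QUARTER POINT with **`χ_Z(σ̃_q) = T`** on OBJECT A7⁺ (type α, `q ≡ 7 (8)`,
# `p ≡ 1 (mod 4)`, **`(p/q) = +1`**), GRANTED `h2 : r_an(49a1^{(−qp)}) = 1`, and the conductor-`1` Heegner trace is NON-TORSION by the χ_Z channel (Z1)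

Cell `bsd-goldfeld`, seat `bsd-goldfeld-s1p-c3x` (gen 15). PLUS TWIN of C7A-Z2 `…QuarterTraceChiZAlphaModFourAlpha` with the OTHER genus lift:
`σ̃_q` (`σ̃_qr_q = −r_q`, `σ̃_qr_p = r_p`) in place of `σ̃_p`. STATEMENT DELTA (exactly): binder `h4e : ∀ Δ, Δ.D = −qp → ¬ 4 ∣ #Cl(𝒪_Δ)` ↦
**`hpq : jacobiSym p q = 1`**; binder `hBodd` DROPPED (idle); `(hσq : σ̃r_q = r_q) (hσp : σ̃r_p = −r_p)` ↦ **`(hσq : σ̃r_q = −r_q) (hσp : σ̃r_p = r_p)`**.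
§0 (NEW, fact-free group algebra) `exists_odd_zsmul_map_sub_eq_twoTorsion_plus` = X4's core at `σ̃_q`: THREE `T`-signatures
(`s_Y(σ̃_q) = 1` Birch: `Y + σ̃_qY = T` — the χ_q package's own clause; `s_p(σ̃_q) = [α] = 1`: Z⁺-0 `exists_chiP_package_alpha_L_plusModFourAlpha`;
`s_e(σ̃_q) = [h2] = 1` at `(p/q) = +1`: E⁺-3 `exists_chiE_package_alpha_L_plusModFourAlpha`) and `[η_{σ̃_q}]₂ = O` (X1 §5 / X2's key lemma
`exists_odd_zsmul_cosetEta_eq_zero`, read at the `(−,+)` coset with the roles of `r_q`, `r_p` exchanged — it is symmetric) give `χ_Z(σ̃_q) = T + T + T = T`.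
§1 `exists_quarterPoint_chiZ_alpha_plusModFourAlpha`, §2 `heegnerTrace_not_isOfFinAddOrder_alpha_plusModFour_of_h2` = Z1 ∘ §1 (Z1's
`trace_not_isOfFinAddOrder_of_quarterPoint` is lift-agnostic). `--supports stmt-BirchSwinnertonDyer-20044 --as helper` (rank axis). Theses-free; theorems only;
no definition, no new fact, no `sorry`. Binders BY NAME as in the source. FRONTIER-grade: twist-density-ZERO sub-family modulo named print; never
distance-to-summit. HONEST FRAMING: items 19140 / 20044 unchanged; BSD is not proved by any of this.
-/

noncomputable section

open scoped Classical IntermediateField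

open WeierstrassCurve NumberField Literature.NumberTheory Literature.NumberTheory.EllipticCurves
  Literature.NumberTheory.EllipticCurves.ModularForms Literature.NumberTheory.EllipticCurves.CaiShuTian2014
  Literature.NumberTheory.EllipticCurves.CoatesLiTianZhai2015 Literature.Computability.Cryptography.Hallgren2005

namespace Summit.BirchSwinnertonDyer.BirchSwinnertonDyer.Theorems.GoldfeldGoodTwists

/-! ## §0 X4's core at the lift `σ̃_q`: three `T`-signatures -/
section ChiZCore

variable {M : Type*} [AddCommGroup M]

/-- **The cocycle value `χ_Z(σ̃_q) = T` on the `(p/q) = +1` cells** (X4's core at the other genus lift). With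
`Z = N•Ψ − N_e•R_e − N_q•Y_q − N_p•R_p` (`N_e, N_q, N_p` odd), `k_q•(σY_q + Y_q) = T`, `k_p•(σR_p − R_p) = T`, `k_e•(σR_e + R_e) = T`
and the key lemma `k•(N•(σΨ − Ψ) + 2N_e•R_e + 2N_q•Y_q) = 0` (`k_q, k_p, k_e, k` odd): `σ(n•Z) − n•Z = T + T + T = T` for the odd
`n = k·k_e·k_q·k_p`. [cite: GrossLMS1991, Prop. 5.3] [cite: CoatesLiTianZhai2015, Thm. 2.5] -/
theorem exists_odd_zsmul_map_sub_eq_twoTorsion_plus (σ : M →+ M) {T : M} (hT2 : 2 • T = 0)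
    {Z Ψ Yq Re Rp : M} {N Ne Nq Np : ℤ} (hNe : Odd Ne) (hNq : Odd Nq) (hNp : Odd Np)
    (hZ : Z = N • Ψ - Ne • Re - Nq • Yq - Np • Rp)
    (hYq : ∃ k : ℤ, Odd k ∧ k • (σ Yq + Yq) = T) (hRp : ∃ k : ℤ, Odd k ∧ k • (σ Rp - Rp) = T)
    (hRe : ∃ k : ℤ, Odd k ∧ k • (σ Re + Re) = T)
    (hKey : ∃ k : ℤ, Odd k ∧ k • (N • (σ Ψ - Ψ) + (2 * Ne) • Re + (2 * Nq) • Yq) = 0) :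
    ∃ n : ℤ, Odd n ∧ σ (n • Z) - n • Z = T := by
  obtain ⟨kq, hkq, hkqT⟩ := hYq
  obtain ⟨kp, hkp, hkpT⟩ := hRp
  obtain ⟨ke, hke, hkeT⟩ := hRe
  obtain ⟨k, hk, hk0⟩ := hKey
  refine ⟨k * ke * kq * kp, ((hk.mul hke).mul hkq).mul hkp, ?_⟩
  -- `σZ − Z = [N(σΨ − Ψ) + 2N_eR_e + 2N_qY_q] − N_e(σR_e + R_e) − N_q(σY_q + Y_q) − N_p(σR_p − R_p)`
  have hdiff : σ Z - Z = (N • (σ Ψ - Ψ) + (2 * Ne) • Re + (2 * Nq) • Yq) - Ne • (σ Re + Re) - Nq • (σ Yq + Yq)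
      - Np • (σ Rp - Rp) := by
    rw [hZ]
    simp only [map_sub, map_zsmul, zsmul_sub, smul_add, mul_zsmul, two_zsmul]
    abel
  have hTT : T + T = 0 := by rw [← two_nsmul]; exact hT2
  have hneg : -T = T := neg_eq_iff_add_eq_zero.mpr hTT
  rw [map_zsmul, ← zsmul_sub, hdiff, zsmul_sub, zsmul_sub, zsmul_sub]
  rw [show (k * ke * kq * kp) • (N • (σ Ψ - Ψ) + (2 * Ne) • Re + (2 * Nq) • Yq) = 0 by
        rw [show k * ke * kq * kp = (ke * kq * kp) * k by ring, mul_zsmul, hk0, zsmul_zero],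
      show (k * ke * kq * kp) • (Ne • (σ Re + Re)) = T by
        rw [smul_smul, show k * ke * kq * kp * Ne = (k * kq * kp * Ne) * ke by ring, mul_zsmul, hkeT,
          zsmul_twoTorsion_of_odd hT2 (((hk.mul hkq).mul hkp).mul hNe)],
      show (k * ke * kq * kp) • (Nq • (σ Yq + Yq)) = T by
        rw [smul_smul, show k * ke * kq * kp * Nq = (k * ke * kp * Nq) * kq by ring, mul_zsmul, hkqT,
          zsmul_twoTorsion_of_odd hT2 (((hk.mul hke).mul hkp).mul hNq)],
      show (k * ke * kq * kp) • (Np • (σ Rp - Rp)) = T by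
        rw [smul_smul, show k * ke * kq * kp * Np = (k * ke * kq * Np) * kp by ring, mul_zsmul, hkpT,
          zsmul_twoTorsion_of_odd hT2 (((hk.mul hke).mul hkq).mul hNp)]]
  rw [zero_sub, hneg, sub_self, zero_sub, hneg]

end ChiZCore

-- the cell's point-group world over `K[1]` / `ℂ` (A⁗_α's, X1's); file-local
attribute [local instance 2000] Classical.propDecidable

/-! ## §1 The quarter point of the α⁺ cell in `X₀(49)(K[1])` and its χ_Z-signature `σ̃_q(n•Z) − n•Z = T` -/
section QuarterPoint
variable {K : Type} [Field K] [NumberField K] (ι : K →+* ℂ) [FiniteDimensional K (ringClassField K ι 1)]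
  [IsGalois K (ringClassField K ι 1)] [NumberField (ringClassField K ι 1)]

/-- **The quarter point with `χ_Z(σ̃_q) = T`, type α at `(p/q) = +1`, under `h2`.** Packages of X3a / Z⁺-0 / E⁺-3, carry binders `hA`, `har`, `hpq`,
`hSK` and the genus subgroup data as in A⁗_α; for a lift `σ̃` (`σ̃r_q = −r_q`, `σ̃r_p = r_p`): an odd `N`, `Z`, `t ∈ {O, T}` with
`4•Z = N•Σ_σ σy_K + t` and an odd `n` with `σ̃(n•Z) − n•Z = T`. [cite: Gross1984, §§4–5] [cite: GrossLMS1991, Prop. 5.3]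
[cite: CoatesLiTianZhai2015, Thm. 1.3, 1.4, 4.4 and (2.8)] -/
theorem exists_quarterPoint_chiZ_alpha_plusModFourAlpha (hEta₀ : x049_x_sub_two_eq_etaQuotient) (hD : deuring_etaQuotient49_heegner_generates_conjPrime)
    (hEta : x049_heegner_norm_x_sub_two_not_mem) (h14 : thm14_rankOne_twist) (hCST : thm11_ringClassChar)
    (hGZ : ∀ (N : ℕ) [NeZero N] (W : WeierstrassCurve ℚ) (K : Type) [Field K] [NumberField K], gross_zagier N W K)
    (h12 : thm12_fullBSD_twist) (h44 : thm44_ord_two_LAlg)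
    (hS31 : bsdTriple_of_rank_le_one_of_conductor_lt) (hnew : exists_isNewformOf)
    (hBT : burungaleTian_analyticRank_eq_zero_of_selmerCorank_eq_zero_of_hasCM) (hBF : bsdTriple_of_hasCM_of_L_one_ne_zero)
    (hGZK : rank_eq_analyticRank_of_analyticRank_le_one)
    (hK : IsImaginaryQuadratic K) {q p : ℕ} (hq : q.Prime) (hq8 : q % 8 = 7) (hq7 : jacobiSym q 7 = -1)
    [Fact p.Prime] (hp4 : p % 4 = 1) (hp7 : legendreSym p (-7) = 1) (hα : ¬ ∃ x : ZMod p, x ^ 4 = -7)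
    (hpq : jacobiSym (p : ℤ) q = 1)
    (h2 : (haveI := cm7.isElliptic_quadraticTwist (show (-((q : ℚ) * p)) ≠ 0 from neg_ne_zero.mpr (mul_ne_zero
        (by exact_mod_cast hq.ne_zero) (by exact_mod_cast (Fact.out : p.Prime).ne_zero)));
      (cm7.quadraticTwist (-((q : ℚ) * p))).analyticRank) = 1)
    (hA : ∀ (K₂ : Type) [Field K₂] [NumberField K₂], IsImaginaryQuadratic K₂ → NumberField.discr K₂ = -(8 * (q : ℤ)) →
      ∀ P : (cm7.baseChange K₂).toAffine.Point, IsHeegnerPoint 49 cm7 K₂ P → ¬ IsOfFinAddOrder P)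
    (har : ∀ (W : WeierstrassCurve ℚ) [W.IsElliptic] (C : VariableChange ℚ),
      C • W = cm7.quadraticTwist ((-2 * q : ℤ) : ℚ) → W.analyticRank = 1)
    (hdK : NumberField.discr K = -(8 * (q : ℤ) * p))
    (D₀ : ModularParametrizationData cm7 49) (hc : |D₀.c| = 1) (hw : cm7.rootNumber = 1)
    (h0 : ∃ h, D₀.cuspZeroPoint = Affine.Point.some 2 (-1) h)
    {β : ℤ} (d : KolyvaginHeegnerData D₀ β ι 1) {rq rp : ringClassField K ι 1}
    (hrq : (rq : ℂ) ^ 2 = -(q : ℂ)) (hrp : (rp : ℂ) ^ 2 = (p : ℂ))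
    (B : AddSubgroup (cm7.baseChange ℂ).toAffine.Point) (S : Subfield ℂ)
    (hBfix : ∀ P : (cm7.baseChange (ringClassField K ι 1)).toAffine.Point,
      (∀ σ : ringClassField K ι 1 ≃ₐ[K] ringClassField K ι 1, σ rq = rq → σ rp = rp →
        Affine.Point.map (σ : ringClassField K ι 1 →ₐ[K] ringClassField K ι 1) P = P) →
      Affine.Point.map (W' := cm7) (ringClassField K ι 1).subtype.toRatAlgHom P ∈ B)
    (hBS : ∀ (E : Type) [Field E] [CharZero E] (e : E →+* ℂ), e.fieldRange ≤ S →
      ∀ z : (cm7.baseChange E).toAffine.Point, Affine.Point.map (W' := cm7) e.toRatAlgHom z ∈ B)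
    (hSK : ∀ k : K, ι k ∈ S) (hSq : (rq : ℂ) ∈ S) (hSp : (rp : ℂ) ∈ S)
    (hBL : ∀ z ∈ B, ∃ P : (cm7.baseChange (ringClassField K ι 1)).toAffine.Point,
      Affine.Point.map (W' := cm7) (ringClassField K ι 1).subtype.toRatAlgHom P = z)
    (h7 : ¬ IsSquare (-7 : ringClassField K ι 1)) (h7' : ¬ IsSquare (7 : ringClassField K ι 1))
    (σt : ringClassField K ι 1 ≃ₐ[K] ringClassField K ι 1) (hσq : σt rq = -rq) (hσp : σt rp = rp) :
    ∃ (N : ℤ) (Z t : (cm7.baseChange (ringClassField K ι 1)).toAffine.Point), Odd N ∧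
      (t = 0 ∨ t = Affine.Point.some 2 (-1) (nonsingular_cm7_baseChange_two_neg_one (ringClassField K ι 1))) ∧
      (4 : ℤ) • Z = N • (∑ σ : ringClassField K ι 1 ≃ₐ[K] ringClassField K ι 1,
          Affine.Point.map (σ : ringClassField K ι 1 →ₐ[K] ringClassField K ι 1) d.y) + t ∧
      ∃ n : ℤ, Odd n ∧ Affine.Point.map (σt : ringClassField K ι 1 →ₐ[K] ringClassField K ι 1) (n • Z) - n • Z =
        Affine.Point.some 2 (-1) (nonsingular_cm7_baseChange_two_neg_one (ringClassField K ι 1)) := by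
  haveI : (cm7.baseChange (ringClassField K ι 1)).IsElliptic := by rw [WeierstrassCurve.baseChange]; infer_instance
  have hp : p.Prime := Fact.out
  obtain ⟨hq4, h3, hq2, -⟩ := mod_eight_eq_seven_arith hq8
  have hrK := sq_eq_algebraMap_neg_natCast (ι := ι) hrq
  have hrpK := sq_eq_algebraMap_natCast' (ι := ι) hrp
  have hpL : (p : ringClassField K ι 1) ≠ 0 := by exact_mod_cast hp.ne_zero
  have hrp0 : rp ≠ 0 := by
    intro h; rw [h, zero_pow two_ne_zero, map_natCast] at hrpK
    exact hpL hrpK.symm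
  have hq0 : (q : ringClassField K ι 1) ≠ 0 := by exact_mod_cast hq.ne_zero
  have hrq0 : rq ≠ 0 := by
    intro h; rw [h, zero_pow two_ne_zero, map_neg, map_natCast] at hrK
    exact hq0 (neg_eq_zero.mp hrK.symm)
  have hT2 : 2 • Affine.Point.some 2 (-1) (nonsingular_cm7_baseChange_two_neg_one (ringClassField K ι 1)) = 0 := by
    rw [two_nsmul]; exact cm7_twoTorsion_add_self _
  have h4 : ∀ x : (cm7.baseChange (ringClassField K ι 1)).toAffine.Point, (4 : ℤ) • x = 0 →
      x = 0 ∨ x = Affine.Point.some 2 (-1) (nonsingular_cm7_baseChange_two_neg_one (ringClassField K ι 1)) := fun x hx ↦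
    cm7_mem_pair_of_four_zsmul_eq_zero h7 h7' hx
  ------------------------------------------------------------------ X2's coordinates of `y₁ = d.y` and the non-square partial norms
  obtain ⟨x₁, y₁, hxy, hdy, hX2⟩ := exists_heegner_x_not_isSquare_seven_mul_prod hEta₀ hD hEta hK ι D₀ hc d
  have hx2 : x₁ ≠ 2 := fun h ↦ hX2 {1} (by
    rw [Finset.prod_singleton, AlgEquiv.one_apply, h, sub_self, mul_zero]; exact ⟨0, (mul_zero 0).symm⟩)
  ------------------------------------------------------------------ the three packages over `K[1]` (X3a, X3b-2b)
  obtain ⟨Mq, m, Y, tq, hMq, hm, htq, hPq, -, hYanti⟩ := exists_chiQ_package_L_modFourAlpha ι h14 hCST hGZ h44 hBT hBF hnew hK hq h3 hq4 hq7 hp4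
    hp7 hα hdK D₀ hc hw h0 d hrq hrp
  obtain ⟨Mp, Rp, tp, hMp, htp, -, -, hPp, hsigP⟩ := exists_chiP_package_alpha_L_plusModFourAlpha ι hEta₀ hD hEta hCST hGZ h12 h44 h14 hS31 hnew
    hBT hBF hGZK hK hq hq8 hq7 hp4 hp7 hα hdK hA har D₀ hc hw h0 d hrq hrp B S hBfix hBS hSK hSq hSp hBL
  obtain ⟨Me, Re, te, hMe, hte, -, -, hPe, hsig⟩ := exists_chiE_package_alpha_L_plusModFourAlpha ι hEta₀ hD hEta h14 hCST hGZ h12 h44 hS31 hnew hBT hBF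
    hGZK hK hq h3 hq4 hq7 hp4 hp7 hα hpq hdK h2 D₀ hc hw h0 d hrq hrp B S hBfix hBS hSq hSp hBL
  have hte' := cm7_exists_odd_zsmul_mem_pair h7 h7' hte
  have htq' := cm7_exists_odd_zsmul_mem_pair h7 h7' htq
  have htp' := cm7_exists_odd_zsmul_mem_pair h7 h7' htp
  ------------------------------------------------------------------ the quarter trace `Ψ` and the quarter point `Z` (X5-prep)
  obtain ⟨Ψ, hΨ⟩ : ∃ X : (cm7.baseChange (ringClassField K ι 1)).toAffine.Point, X =
      ∑ σ : ringClassField K ι 1 ≃ₐ[K] ringClassField K ι 1, (@ite ℤ (σ rq = rq ∧ σ rp = rp) instDecidableAnd (1 : ℤ) 0) •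
        Affine.Point.map (σ : ringClassField K ι 1 →ₐ[K] ringClassField K ι 1) d.y := ⟨_, rfl⟩
  have hΨ4 : (4 : ℤ) • Ψ = (∑ σ : ringClassField K ι 1 ≃ₐ[K] ringClassField K ι 1,
        Affine.Point.map (σ : ringClassField K ι 1 →ₐ[K] ringClassField K ι 1) d.y) +
      (∑ σ : ringClassField K ι 1 ≃ₐ[K] ringClassField K ι 1,
        ((if σ rq = rq then (1 : ℤ) else -1) * (if σ rp = rp then (1 : ℤ) else -1)) •
          Affine.Point.map (σ : ringClassField K ι 1 →ₐ[K] ringClassField K ι 1) d.y) +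
      (∑ σ : ringClassField K ι 1 ≃ₐ[K] ringClassField K ι 1, (if σ rq = rq then (1 : ℤ) else -1) •
          Affine.Point.map (σ : ringClassField K ι 1 →ₐ[K] ringClassField K ι 1) d.y) +
      (∑ σ : ringClassField K ι 1 ≃ₐ[K] ringClassField K ι 1, (if σ rp = rp then (1 : ℤ) else -1) •
          Affine.Point.map (σ : ringClassField K ι 1 →ₐ[K] ringClassField K ι 1) d.y) := by
    rw [hΨ]
    exact quarterTrace_sum_identity (fun σ : ringClassField K ι 1 ≃ₐ[K] ringClassField K ι 1 ↦ σ rq = rq) (fun σ ↦ σ rp = rp)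
      (fun σ ↦ Affine.Point.map (σ : ringClassField K ι 1 →ₐ[K] ringClassField K ι 1) d.y)
  obtain ⟨n₀, t, hn₀, ht, hZ4⟩ := four_zsmul_quarterPoint hT2 hΨ4 hPe hPq hPp hte' htq' htp'
  obtain ⟨Z, hZ⟩ : ∃ X : (cm7.baseChange (ringClassField K ι 1)).toAffine.Point,
      X = (n₀ * (Me * Mq * Mp)) • Ψ - (n₀ * (Mq * Mp)) • Re - (n₀ * (Me * Mp)) • (m • Y) - (n₀ * (Me * Mq)) • Rp := ⟨_, rfl⟩
  rw [mul_zsmul Y (n₀ * (Me * Mp)) m, ← hZ] at hZ4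
  ------------------------------------------------------------------ `hKey`: `[η_σ̃_q]₂ = O` (X1 §5 at the `(−,+)` coset: X2's key lemma with the roles of `r_q`, `r_p` exchanged)
  have hPe' := hPe
  have hPq' := hPq
  rw [hdy] at hPe' hPq'
  have hPe'' : Me • (∑ σ : ringClassField K ι 1 ≃ₐ[K] ringClassField K ι 1,
      ((if σ rp = rp then (1 : ℤ) else -1) * (if σ rq = rq then (1 : ℤ) else -1)) •
        Affine.Point.map (σ : ringClassField K ι 1 →ₐ[K] ringClassField K ι 1) (Affine.Point.some x₁ y₁ hxy)) = (4 : ℤ) • Re + te := by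
    rw [← hPe']; congr 1; exact Finset.sum_congr rfl fun σ _ ↦ by rw [mul_comm]
  have hPq'' : Mq • (∑ σ : ringClassField K ι 1 ≃ₐ[K] ringClassField K ι 1, (if σ rq = rq then (1 : ℤ) else -1) •
        Affine.Point.map (σ : ringClassField K ι 1 →ₐ[K] ringClassField K ι 1) (Affine.Point.some x₁ y₁ hxy)) = (4 : ℤ) • (m • Y) + tq := by
    rw [hPq', smul_smul]
  obtain ⟨kK, hkK, hK0⟩ := exists_odd_zsmul_cosetEta_eq_zero (K := K) hrK hrq0 hxy hx2 hX2 h4 (hn₀.mul ((hMe.mul hMq).mul hMp))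
    (show n₀ * (Me * Mq * Mp) = (n₀ * (Mq * Mp)) * Me by ring) (show n₀ * (Me * Mq * Mp) = (n₀ * (Me * Mp)) * Mq by ring)
    hPe'' hPq'' hte' htq'
  rw [← hdy] at hK0
  -- the quarter sum with the conjuncts exchanged
  have hΨswap : (∑ σ : ringClassField K ι 1 ≃ₐ[K] ringClassField K ι 1, (@ite ℤ (σ rp = rp ∧ σ rq = rq) instDecidableAnd (1 : ℤ) 0) •
        Affine.Point.map (σ : ringClassField K ι 1 →ₐ[K] ringClassField K ι 1) d.y) = Ψ := by
    rw [hΨ]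
    exact Finset.sum_congr rfl fun σ _ ↦ by
      by_cases h1 : σ rp = rp <;> by_cases h2 : σ rq = rq <;> simp [h1, h2]
  rw [hΨswap] at hK0
  -- `σ̃_qΨ = Ψ₋₊` (X1 §3, roles exchanged)
  have hcos : Affine.Point.map (σt : ringClassField K ι 1 →ₐ[K] ringClassField K ι 1) Ψ =
      ∑ σ : ringClassField K ι 1 ≃ₐ[K] ringClassField K ι 1, (@ite ℤ (σ rp = rp ∧ σ rq = -rq) instDecidableAnd (1 : ℤ) 0) •
        Affine.Point.map (σ : ringClassField K ι 1 →ₐ[K] ringClassField K ι 1) d.y := by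
    rw [← hΨswap]; exact map_quarterSum_eq_cosetSum σt hrpK hrK hrq0 hσp hσq d.y
  -- `s_Y(σ̃_q) = 1` (Birch): `σ̃_q(m•Y) + m•Y = m•T = T`, `m` odd
  have hYq : ∃ k : ℤ, Odd k ∧ k • (Affine.Point.map (σt : ringClassField K ι 1 →ₐ[K] ringClassField K ι 1) (m • Y) + m • Y) =
      Affine.Point.some 2 (-1) (nonsingular_cm7_baseChange_two_neg_one (ringClassField K ι 1)) :=
    ⟨1, odd_one, by
      rw [one_zsmul, map_zsmul, ← zsmul_add, add_comm, hYanti σt hσq]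
      exact zsmul_twoTorsion_of_odd hT2 hm⟩
  ------------------------------------------------------------------ X4's core at `σ̃_q`: `χ_Z(σ̃_q) = T + T + T = T`
  have hχ := exists_odd_zsmul_map_sub_eq_twoTorsion_plus
    (Affine.Point.map (σt : ringClassField K ι 1 →ₐ[K] ringClassField K ι 1)) hT2 (hn₀.mul (hMq.mul hMp)) (hn₀.mul (hMe.mul hMp)) (hn₀.mul (hMe.mul hMq)) hZ hYq
    (hsigP σt hσq hσp) (hsig σt hσq hσp) ⟨kK, hkK, by rw [hcos]; exact hK0⟩
  exact ⟨n₀ * (Me * Mq * Mp), Z, t, hn₀.mul ((hMe.mul hMq).mul hMp), ht, hZ4, hχ⟩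

/-! ## §2 The conductor-`1` Heegner trace is non-torsion on the type-α⁺ cells, GRANTED `h2` (the χ_Z channel at `σ̃_q`; no `(1+c)`-parity) -/

/-- **Type α, `q ≡ 7 (8)`, `p ≡ 1 (mod 4)`, `(p/q) = +1` (a71+ ∪ a75+), GRANTED `h2`: the conductor-`1` trace `Σ_σ σ y₁ ∈ X₀(49)(K[1])` has INFINITE
order** — Z1's `trace_not_isOfFinAddOrder_of_quarterPoint` on §1's quarter point (`χ_Z(σ̃_q) = T`). `h2` is D3⁺
`analyticRank_eq_one_oddTwoPrimesTwist_of_thmA_plusPOneAlpha` / `…_plusPFiveAlpha`. [cite: GrossLMS1991, Prop. 5.3] [cite: Gross1984, §§4–5]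
[cite: CoatesLiTianZhai2015, Thm. 1.3, 1.4, 4.4 and (2.8)] -/
theorem heegnerTrace_not_isOfFinAddOrder_alpha_plusModFour_of_h2 (hEta₀ : x049_x_sub_two_eq_etaQuotient) (hD : deuring_etaQuotient49_heegner_generates_conjPrime)
    (hEta : x049_heegner_norm_x_sub_two_not_mem) (h14 : thm14_rankOne_twist) (hCST : thm11_ringClassChar)
    (hGZ : ∀ (N : ℕ) [NeZero N] (W : WeierstrassCurve ℚ) (K : Type) [Field K] [NumberField K], gross_zagier N W K)
    (h12 : thm12_fullBSD_twist) (h44 : thm44_ord_two_LAlg)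
    (hS31 : bsdTriple_of_rank_le_one_of_conductor_lt) (hnew : exists_isNewformOf)
    (hBT : burungaleTian_analyticRank_eq_zero_of_selmerCorank_eq_zero_of_hasCM) (hBF : bsdTriple_of_hasCM_of_L_one_ne_zero)
    (hGZK : rank_eq_analyticRank_of_analyticRank_le_one)
    (hK : IsImaginaryQuadratic K) {q p : ℕ} (hq : q.Prime) (hq8 : q % 8 = 7) (hq7 : jacobiSym q 7 = -1)
    [Fact p.Prime] (hp4 : p % 4 = 1) (hp7 : legendreSym p (-7) = 1) (hα : ¬ ∃ x : ZMod p, x ^ 4 = -7)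
    (hpq : jacobiSym (p : ℤ) q = 1)
    (h2 : (haveI := cm7.isElliptic_quadraticTwist (show (-((q : ℚ) * p)) ≠ 0 from neg_ne_zero.mpr (mul_ne_zero
        (by exact_mod_cast hq.ne_zero) (by exact_mod_cast (Fact.out : p.Prime).ne_zero)));
      (cm7.quadraticTwist (-((q : ℚ) * p))).analyticRank) = 1)
    (hA : ∀ (K₂ : Type) [Field K₂] [NumberField K₂], IsImaginaryQuadratic K₂ → NumberField.discr K₂ = -(8 * (q : ℤ)) →
      ∀ P : (cm7.baseChange K₂).toAffine.Point, IsHeegnerPoint 49 cm7 K₂ P → ¬ IsOfFinAddOrder P)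
    (har : ∀ (W : WeierstrassCurve ℚ) [W.IsElliptic] (C : VariableChange ℚ),
      C • W = cm7.quadraticTwist ((-2 * q : ℤ) : ℚ) → W.analyticRank = 1)
    (hdK : NumberField.discr K = -(8 * (q : ℤ) * p))
    (D₀ : ModularParametrizationData cm7 49) (hc : |D₀.c| = 1) (hw : cm7.rootNumber = 1)
    (h0 : ∃ h, D₀.cuspZeroPoint = Affine.Point.some 2 (-1) h)
    {β : ℤ} (d : KolyvaginHeegnerData D₀ β ι 1) {rq rp : ringClassField K ι 1}
    (hrq : (rq : ℂ) ^ 2 = -(q : ℂ)) (hrp : (rp : ℂ) ^ 2 = (p : ℂ))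
    (B : AddSubgroup (cm7.baseChange ℂ).toAffine.Point) (S : Subfield ℂ)
    (hBfix : ∀ P : (cm7.baseChange (ringClassField K ι 1)).toAffine.Point,
      (∀ σ : ringClassField K ι 1 ≃ₐ[K] ringClassField K ι 1, σ rq = rq → σ rp = rp →
        Affine.Point.map (σ : ringClassField K ι 1 →ₐ[K] ringClassField K ι 1) P = P) →
      Affine.Point.map (W' := cm7) (ringClassField K ι 1).subtype.toRatAlgHom P ∈ B)
    (hBS : ∀ (E : Type) [Field E] [CharZero E] (e : E →+* ℂ), e.fieldRange ≤ S →
      ∀ z : (cm7.baseChange E).toAffine.Point, Affine.Point.map (W' := cm7) e.toRatAlgHom z ∈ B)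
    (hSK : ∀ k : K, ι k ∈ S) (hSq : (rq : ℂ) ∈ S) (hSp : (rp : ℂ) ∈ S)
    (hBL : ∀ z ∈ B, ∃ P : (cm7.baseChange (ringClassField K ι 1)).toAffine.Point,
      Affine.Point.map (W' := cm7) (ringClassField K ι 1).subtype.toRatAlgHom P = z)
    (h7 : ¬ IsSquare (-7 : ringClassField K ι 1)) (h7' : ¬ IsSquare (7 : ringClassField K ι 1))
    (σt : ringClassField K ι 1 ≃ₐ[K] ringClassField K ι 1) (hσq : σt rq = -rq) (hσp : σt rp = rp) :
    ¬ IsOfFinAddOrder (∑ σ : ringClassField K ι 1 ≃ₐ[K] ringClassField K ι 1,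
        Affine.Point.map (σ : ringClassField K ι 1 →ₐ[K] ringClassField K ι 1) d.y) := by
  obtain ⟨N, Z, t, -, ht, hZ4, hχ⟩ := exists_quarterPoint_chiZ_alpha_plusModFourAlpha ι hEta₀ hD hEta h14 hCST hGZ h12 h44 hS31 hnew hBT hBF hGZK hK hq
    hq8 hq7 hp4 hp7 hα hpq h2 hA har hdK D₀ hc hw h0 d hrq hrp B S hBfix hBS hSK hSq hSp hBL h7 h7' σt hσq hσp
  exact trace_not_isOfFinAddOrder_of_quarterPoint hEta hK ι D₀ hc d σt ht hZ4 hχ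

end QuarterPoint

end Summit.BirchSwinnertonDyer.BirchSwinnertonDyer.Theorems.GoldfeldGoodTwists

end
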